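import Literature.MathematicalPhysics.QuantumFieldTheory.Balaban1983to89.B9Eq3117Current
import Literature.MathematicalPhysics.QuantumFieldTheory.Balaban1983to89.B9Eq33CovDerivVector

/-!
# `Balaban1983to89.B9Eq3117ConjugationDefects` — T. Bałaban, *Propagators for lattice gauge theories in a background field*, Commun. Math. Phys. **99** (1985)
# 389–434 [Balaban1985BackgroundPropagators] (3.5)–(3.7) p. 391, (3.8)–(3.11) p. 392 (the current `J = D*η⁻²Im ∂U`), (3.35)–(3.36) p. 396: **CONJUGATION DEFECTS OF
# NEAR-IDENTITY UNITS TO SECOND ORDER, AND THE CURRENT (3.11) UNFOLDED ON THE MODEL'S TORUS** — the algebra half of this lineage's bound on the lattice commutator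
# `[D*_UD_U, D_U]` (`B9Eq3117CommutatorBound`): `PXP⁻¹ − X = [P − 1, X] + O(‖P − 1‖²)`, `P − 1 = i·Im P + O(‖P − 1‖²)`, hence a SUM of conjugation defects
# `Σ_i(P_iYP_i⁻¹ − Y)` is controlled by `‖Σ_i Im P_i‖` plus second-order terms (`norm_sum_conj_sub_self_le`) — the mechanism by which the current `J` (a covariant
# sum of `Im U(∂p)` around a bond, `J_eq_sum`) controls the plaquette defects of the commutator.  NE9 crux-team LEAF PROVER 01, gen 95.

statement-level skeleton of published theorems with citation tags; proofs where landed; nothing here is a claim about the Yang–Mills mass gap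

CITATION HEADER (lean-in-tree rule).  Audit cell `pub-balaban`, sub-cell `t4`, BINDER row NE9; filed by NE9 crux-team LEAF PROVER 01 (`b2b-balaban-t4-ne9-formalise-leaf-01`,
gen 95; bears_on: R4/N22).  Source READ first-hand (`paper:balaban1985-cmp99-background-propagators`, pp. 391–392, 396).  The CONTENT is [folklore] finite algebra and norm
bookkeeping in a normed ring, in the vocabulary of `B9Eq39Adjoint` (`R`, `plaqU`, `covDstar`, `divP`, `divPη`, `J`) and `B9Eq37Insertion` (`imC`); REUSED BY NAME:
`B9Eq3117Current.imC_plaqU_swap`, `B9Eq37Insertion.imC_one`, `B9Eq39Adjoint.divP_eq_sum_of_antisymm`, `R_smul`, `R_def`.  Nothing printed is a hypothesis.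

WHAT IS PROVED (sorry-free; proof lane — 0 `def`).
* §1 `norm_conj_sub_conj_le` (`‖VXV⁻¹ − V′XV′⁻¹‖ ≤ 2‖V − V′‖‖X‖`), `norm_conj_sub_self_le` (`‖PXP⁻¹ − X‖ ≤ 2‖P − 1‖‖X‖`), `norm_conj_sub_sub_comm_le`
  (`‖(PXP⁻¹ − X) − ((P − 1)X − X(P − 1))‖ ≤ 2‖P − 1‖²‖X‖`), `norm_sub_one_sub_smul_imC_le` (`‖(P − 1) − i·Im P‖ ≤ ‖P − 1‖²`), and the summed form
  **`norm_sum_conj_sub_self_le`**: `‖Σ_i(P_iYP_i⁻¹ − Y)‖ ≤ (2‖Σ_i Im P_i‖ + 4|ι|ε²)·‖Y‖` for `‖P_i − 1‖ ≤ ε`, `‖P_i⁻¹‖ ≤ 1`.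
* §2 `plaqU_self` (`U(∂p_{κκ}) = 1`) and **`J_eq_sum`**: on the torus `TSite d Pd` with unit steps `shiftEquiv` and a bond configuration `U`,
  `J_ν(x) = η⁻³·Σ_κ(U_{x−e_κ,κ}⁻¹·Im U(∂p_{κν}(x−e_κ))·U_{x−e_κ,κ} − Im U(∂p_{κν}(x)))`.
HONEST SCOPE.  [folklore]; no estimate of print's propagators; NOT summit progress (cell pub-balaban: NE9 NOT PRINTED ∕ NOT PROVED; «NE9 ⇐ the named binders»; row WALLED ON A
MODEL (O-NE9-1; #5 UNRULED); spine PROVED 0∕9; rung (B)+1 finite T⁴ — NOT infinite volume, NOT mass gap, NOT BetaPertH, NOT Clay).  NEW file; nothing modified.  Net new unproved facts: 0.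
-/

noncomputable section

open scoped BigOperators
open Complex

namespace Literature.MathematicalPhysics.QuantumFieldTheory.Balaban1983to89.B9Eq3117ConjugationDefects

open B4Sect5Torus (TSite)
open B9SectCLatticeCarrier (Bond shift unshift)
open B9Eq33CovDerivVector (shiftEquiv)
open B9Eq37Insertion (imC imC_one)
open B9Eq39Adjoint (R R_def plaqU covDstar divP divPη J divP_eq_sum_of_antisymm)
open B9Eq3117Current (imC_plaqU_swap)

/-! ## §1 Algebra in `𝔸`: conjugation defects -/

section Algebra

variable {𝔸 : Type*} [NormedRing 𝔸] [NormedAlgebra ℂ 𝔸] [NormOneClass 𝔸]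

omit [NormedAlgebra ℂ 𝔸] [NormOneClass 𝔸] in
/-- **`‖VXV⁻¹ − V′XV′⁻¹‖ ≤ 2‖V − V′‖‖X‖`** for units with `‖V′‖, ‖V⁻¹‖, ‖V′⁻¹‖ ≤ 1`
(`VXV⁻¹ − V′XV′⁻¹ = (V − V′)XV⁻¹ + V′X·V⁻¹(V′ − V)V′⁻¹`). [folklore] [cite: Balaban1985BackgroundPropagators, (3.35) p.396] -/
theorem norm_conj_sub_conj_le (V V' : 𝔸ˣ) (hV' : ‖(V' : 𝔸)‖ ≤ 1) (hVi : ‖((V⁻¹ : 𝔸ˣ) : 𝔸)‖ ≤ 1) (hV'i : ‖((V'⁻¹ : 𝔸ˣ) : 𝔸)‖ ≤ 1) (X : 𝔸) :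
    ‖(V : 𝔸) * X * ((V⁻¹ : 𝔸ˣ) : 𝔸) - (V' : 𝔸) * X * ((V'⁻¹ : 𝔸ˣ) : 𝔸)‖ ≤ 2 * ‖(V : 𝔸) - V'‖ * ‖X‖ := by
  have hinv : ((V⁻¹ : 𝔸ˣ) : 𝔸) - ((V'⁻¹ : 𝔸ˣ) : 𝔸) = ((V⁻¹ : 𝔸ˣ) : 𝔸) * ((V' : 𝔸) - V) * ((V'⁻¹ : 𝔸ˣ) : 𝔸) := by
    rw [mul_sub, sub_mul, Units.mul_inv_cancel_right, Units.inv_mul, one_mul]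
  have e : (V : 𝔸) * X * ((V⁻¹ : 𝔸ˣ) : 𝔸) - (V' : 𝔸) * X * ((V'⁻¹ : 𝔸ˣ) : 𝔸) =
      ((V : 𝔸) - V') * X * ((V⁻¹ : 𝔸ˣ) : 𝔸) + (V' : 𝔸) * X * (((V⁻¹ : 𝔸ˣ) : 𝔸) - ((V'⁻¹ : 𝔸ˣ) : 𝔸)) := by noncomm_ring
  rw [e, hinv]
  have h1 : ‖((V : 𝔸) - V') * X * ((V⁻¹ : 𝔸ˣ) : 𝔸)‖ ≤ ‖(V : 𝔸) - V'‖ * ‖X‖ := by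
    calc ‖((V : 𝔸) - V') * X * ((V⁻¹ : 𝔸ˣ) : 𝔸)‖ ≤ ‖((V : 𝔸) - V') * X‖ * ‖((V⁻¹ : 𝔸ˣ) : 𝔸)‖ := norm_mul_le _ _
      _ ≤ (‖(V : 𝔸) - V'‖ * ‖X‖) * 1 := mul_le_mul (norm_mul_le _ _) hVi (norm_nonneg _) (by positivity)
      _ = ‖(V : 𝔸) - V'‖ * ‖X‖ := mul_one _
  have h2 : ‖(V' : 𝔸) * X * (((V⁻¹ : 𝔸ˣ) : 𝔸) * ((V' : 𝔸) - V) * ((V'⁻¹ : 𝔸ˣ) : 𝔸))‖ ≤ ‖(V : 𝔸) - V'‖ * ‖X‖ := by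
    have h3 : ‖((V⁻¹ : 𝔸ˣ) : 𝔸) * ((V' : 𝔸) - V) * ((V'⁻¹ : 𝔸ˣ) : 𝔸)‖ ≤ ‖(V : 𝔸) - V'‖ := by
      calc ‖((V⁻¹ : 𝔸ˣ) : 𝔸) * ((V' : 𝔸) - V) * ((V'⁻¹ : 𝔸ˣ) : 𝔸)‖ ≤ ‖((V⁻¹ : 𝔸ˣ) : 𝔸) * ((V' : 𝔸) - V)‖ * ‖((V'⁻¹ : 𝔸ˣ) : 𝔸)‖ := norm_mul_le _ _
        _ ≤ (‖((V⁻¹ : 𝔸ˣ) : 𝔸)‖ * ‖(V' : 𝔸) - V‖) * 1 := mul_le_mul (norm_mul_le _ _) hV'i (norm_nonneg _) (by positivity)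
        _ ≤ (1 * ‖(V' : 𝔸) - V‖) * 1 := by gcongr
        _ = ‖(V : 𝔸) - V'‖ := by rw [one_mul, mul_one, norm_sub_rev]
    calc ‖(V' : 𝔸) * X * (((V⁻¹ : 𝔸ˣ) : 𝔸) * ((V' : 𝔸) - V) * ((V'⁻¹ : 𝔸ˣ) : 𝔸))‖
        ≤ ‖(V' : 𝔸) * X‖ * ‖((V⁻¹ : 𝔸ˣ) : 𝔸) * ((V' : 𝔸) - V) * ((V'⁻¹ : 𝔸ˣ) : 𝔸)‖ := norm_mul_le _ _
      _ ≤ (‖(V' : 𝔸)‖ * ‖X‖) * ‖(V : 𝔸) - V'‖ := mul_le_mul (norm_mul_le _ _) h3 (norm_nonneg _) (by positivity)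
      _ ≤ (1 * ‖X‖) * ‖(V : 𝔸) - V'‖ := by gcongr
      _ = ‖(V : 𝔸) - V'‖ * ‖X‖ := by ring
  calc _ ≤ ‖((V : 𝔸) - V') * X * ((V⁻¹ : 𝔸ˣ) : 𝔸)‖ + ‖(V' : 𝔸) * X * (((V⁻¹ : 𝔸ˣ) : 𝔸) * ((V' : 𝔸) - V) * ((V'⁻¹ : 𝔸ˣ) : 𝔸))‖ := norm_add_le _ _
    _ ≤ ‖(V : 𝔸) - V'‖ * ‖X‖ + ‖(V : 𝔸) - V'‖ * ‖X‖ := add_le_add h1 h2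
    _ = 2 * ‖(V : 𝔸) - V'‖ * ‖X‖ := by ring

omit [NormedAlgebra ℂ 𝔸] [NormOneClass 𝔸] in
/-- **The conjugation defect to second order**: `‖(PXP⁻¹ − X) − ((P − 1)X − X(P − 1))‖ ≤ 2‖P − 1‖²‖X‖` for `‖P⁻¹‖ ≤ 1`
(`PXP⁻¹ − X − [(P−1), X] = X·P⁻¹(P−1)² − (P−1)·X·P⁻¹(P−1)`). [folklore] [cite: Balaban1985BackgroundPropagators, (3.7) p.391] -/
theorem norm_conj_sub_sub_comm_le (P : 𝔸ˣ) (hPi : ‖((P⁻¹ : 𝔸ˣ) : 𝔸)‖ ≤ 1) (X : 𝔸) :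
    ‖((P : 𝔸) * X * ((P⁻¹ : 𝔸ˣ) : 𝔸) - X) - (((P : 𝔸) - 1) * X - X * ((P : 𝔸) - 1))‖ ≤ 2 * ‖(P : 𝔸) - 1‖ ^ 2 * ‖X‖ := by
  set Q : 𝔸 := ((P⁻¹ : 𝔸ˣ) : 𝔸) with hQ
  have hQP : Q * (P : 𝔸) = 1 := by rw [hQ, Units.inv_mul]
  have r1 : ∀ y : 𝔸, Q * ((P : 𝔸) * y) = y := fun y => by rw [← mul_assoc, hQP, one_mul]
  have key : ((P : 𝔸) * X * Q - X) - (((P : 𝔸) - 1) * X - X * ((P : 𝔸) - 1)) =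
      X * Q * ((P : 𝔸) - 1) * ((P : 𝔸) - 1) - ((P : 𝔸) - 1) * X * Q * ((P : 𝔸) - 1) := by
    simp only [mul_sub, sub_mul, mul_one, one_mul, mul_assoc, hQP]
    abel
  rw [key]
  set E : 𝔸 := (P : 𝔸) - 1 with hE
  have hE2 : ‖X * Q * E * E‖ ≤ ‖E‖ ^ 2 * ‖X‖ := by
    calc ‖X * Q * E * E‖ ≤ ‖X * Q * E‖ * ‖E‖ := norm_mul_le _ _
      _ ≤ (‖X * Q‖ * ‖E‖) * ‖E‖ := by gcongr; exact norm_mul_le _ _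
      _ ≤ ((‖X‖ * ‖Q‖) * ‖E‖) * ‖E‖ := by gcongr; exact norm_mul_le _ _
      _ ≤ ((‖X‖ * 1) * ‖E‖) * ‖E‖ := by gcongr
      _ = ‖E‖ ^ 2 * ‖X‖ := by ring
  have hE3 : ‖E * X * Q * E‖ ≤ ‖E‖ ^ 2 * ‖X‖ := by
    calc ‖E * X * Q * E‖ ≤ ‖E * X * Q‖ * ‖E‖ := norm_mul_le _ _
      _ ≤ (‖E * X‖ * ‖Q‖) * ‖E‖ := by gcongr; exact norm_mul_le _ _
      _ ≤ ((‖E‖ * ‖X‖) * ‖Q‖) * ‖E‖ := by gcongr; exact norm_mul_le _ _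
      _ ≤ ((‖E‖ * ‖X‖) * 1) * ‖E‖ := by gcongr
      _ = ‖E‖ ^ 2 * ‖X‖ := by ring
  calc ‖X * Q * E * E - E * X * Q * E‖ ≤ ‖X * Q * E * E‖ + ‖E * X * Q * E‖ := norm_sub_le _ _
    _ ≤ ‖E‖ ^ 2 * ‖X‖ + ‖E‖ ^ 2 * ‖X‖ := add_le_add hE2 hE3
    _ = 2 * ‖E‖ ^ 2 * ‖X‖ := by ring

omit [NormOneClass 𝔸] in
/-- **`P − 1 = i·Im P + O(‖P − 1‖²)`**: `‖(P − 1) − I•imC P‖ ≤ ‖P − 1‖²` for `‖P⁻¹‖ ≤ 1` (`(P − 1) − (P − P⁻¹)∕2 = (P − 1)(1 − P⁻¹)∕2`).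
[folklore] [cite: Balaban1985BackgroundPropagators, (3.5)–(3.7) p.391] -/
theorem norm_sub_one_sub_smul_imC_le (P : 𝔸ˣ) (hPi : ‖((P⁻¹ : 𝔸ˣ) : 𝔸)‖ ≤ 1) :
    ‖((P : 𝔸) - 1) - I • imC P‖ ≤ ‖(P : 𝔸) - 1‖ ^ 2 := by
  have hprod : ((P : 𝔸) - 1) * (1 - ((P⁻¹ : 𝔸ˣ) : 𝔸)) = (P : 𝔸) + ((P⁻¹ : 𝔸ˣ) : 𝔸) - 1 - 1 := by
    rw [sub_mul, mul_sub, mul_sub, mul_one, one_mul, one_mul, Units.mul_inv]; abel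
  have hI : I * (2 * I)⁻¹ = (1 : ℂ) / 2 := by
    field_simp
  have e : ((P : 𝔸) - 1) - I • imC P = ((1 : ℂ) / 2) • (((P : 𝔸) - 1) * (1 - ((P⁻¹ : 𝔸ˣ) : 𝔸))) := by
    rw [hprod, imC, smul_smul, hI]
    module
  rw [e, norm_smul]
  have hhalf : ‖((1 : ℂ) / 2)‖ = 1 / 2 := by simp
  rw [hhalf]
  have h1 : ‖(1 : 𝔸) - ((P⁻¹ : 𝔸ˣ) : 𝔸)‖ ≤ ‖(P : 𝔸) - 1‖ := by
    have e1 : (1 : 𝔸) - ((P⁻¹ : 𝔸ˣ) : 𝔸) = ((P⁻¹ : 𝔸ˣ) : 𝔸) * ((P : 𝔸) - 1) := by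
      rw [mul_sub, mul_one, Units.inv_mul]
    rw [e1]
    calc ‖((P⁻¹ : 𝔸ˣ) : 𝔸) * ((P : 𝔸) - 1)‖ ≤ ‖((P⁻¹ : 𝔸ˣ) : 𝔸)‖ * ‖(P : 𝔸) - 1‖ := norm_mul_le _ _
      _ ≤ 1 * ‖(P : 𝔸) - 1‖ := by gcongr
      _ = ‖(P : 𝔸) - 1‖ := one_mul _
  have h0 : 0 ≤ ‖(P : 𝔸) - 1‖ := norm_nonneg _
  calc 1 / 2 * ‖((P : 𝔸) - 1) * (1 - ((P⁻¹ : 𝔸ˣ) : 𝔸))‖ ≤ 1 / 2 * (‖(P : 𝔸) - 1‖ * ‖(1 : 𝔸) - ((P⁻¹ : 𝔸ˣ) : 𝔸)‖) :=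
        mul_le_mul_of_nonneg_left (norm_mul_le _ _) (by norm_num)
    _ ≤ 1 / 2 * (‖(P : 𝔸) - 1‖ * ‖(P : 𝔸) - 1‖) := by gcongr
    _ ≤ ‖(P : 𝔸) - 1‖ ^ 2 := by nlinarith [mul_nonneg h0 h0]

omit [NormedAlgebra ℂ 𝔸] [NormOneClass 𝔸] in
/-- **`‖PXP⁻¹ − X‖ ≤ 2‖P − 1‖‖X‖`** for `‖P⁻¹‖ ≤ 1` (`PXP⁻¹ − X = (P − 1)XP⁻¹ + X·P⁻¹(1 − P)`). [folklore]
[cite: Balaban1985BackgroundPropagators, (3.35) p.396] -/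
theorem norm_conj_sub_self_le (P : 𝔸ˣ) (hPi : ‖((P⁻¹ : 𝔸ˣ) : 𝔸)‖ ≤ 1) (X : 𝔸) :
    ‖(P : 𝔸) * X * ((P⁻¹ : 𝔸ˣ) : 𝔸) - X‖ ≤ 2 * ‖(P : 𝔸) - 1‖ * ‖X‖ := by
  have e : (P : 𝔸) * X * ((P⁻¹ : 𝔸ˣ) : 𝔸) - X = ((P : 𝔸) - 1) * X * ((P⁻¹ : 𝔸ˣ) : 𝔸) + X * (((P⁻¹ : 𝔸ˣ) : 𝔸) * (1 - (P : 𝔸))) := by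
    rw [mul_sub, mul_one, Units.inv_mul]; noncomm_ring
  rw [e]
  have h1 : ‖((P : 𝔸) - 1) * X * ((P⁻¹ : 𝔸ˣ) : 𝔸)‖ ≤ ‖(P : 𝔸) - 1‖ * ‖X‖ := by
    calc _ ≤ ‖((P : 𝔸) - 1) * X‖ * ‖((P⁻¹ : 𝔸ˣ) : 𝔸)‖ := norm_mul_le _ _
      _ ≤ (‖(P : 𝔸) - 1‖ * ‖X‖) * 1 := mul_le_mul (norm_mul_le _ _) hPi (norm_nonneg _) (by positivity)
      _ = _ := mul_one _
  have h2 : ‖X * (((P⁻¹ : 𝔸ˣ) : 𝔸) * (1 - (P : 𝔸)))‖ ≤ ‖(P : 𝔸) - 1‖ * ‖X‖ := by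
    calc _ ≤ ‖X‖ * ‖((P⁻¹ : 𝔸ˣ) : 𝔸) * (1 - (P : 𝔸))‖ := norm_mul_le _ _
      _ ≤ ‖X‖ * (‖((P⁻¹ : 𝔸ˣ) : 𝔸)‖ * ‖1 - (P : 𝔸)‖) := by gcongr; exact norm_mul_le _ _
      _ ≤ ‖X‖ * (1 * ‖1 - (P : 𝔸)‖) := by gcongr
      _ = ‖(P : 𝔸) - 1‖ * ‖X‖ := by rw [one_mul, norm_sub_rev, mul_comm]
  calc _ ≤ ‖((P : 𝔸) - 1) * X * ((P⁻¹ : 𝔸ˣ) : 𝔸)‖ + ‖X * (((P⁻¹ : 𝔸ˣ) : 𝔸) * (1 - (P : 𝔸)))‖ := norm_add_le _ _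
    _ ≤ ‖(P : 𝔸) - 1‖ * ‖X‖ + ‖(P : 𝔸) - 1‖ * ‖X‖ := add_le_add h1 h2
    _ = 2 * ‖(P : 𝔸) - 1‖ * ‖X‖ := by ring

omit [NormOneClass 𝔸] in
/-- **A SUM OF CONJUGATION DEFECTS IS CONTROLLED BY THE SUM OF THE IMAGINARY PARTS**: for a finite family of units `P_i` with `‖P_i − 1‖ ≤ ε`, `‖P_i⁻¹‖ ≤ 1`,
`‖Σ_i (P_iYP_i⁻¹ − Y)‖ ≤ (2‖Σ_i Im P_i‖ + 4·|ι|·ε²)·‖Y‖` (`P_iYP_i⁻¹ − Y = [P_i − 1, Y] + O(ε²)`, `P_i − 1 = i·Im P_i + O(ε²)`, and the commutators with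
`i·Im P_i` SUM to the commutator with `i·Σ_i Im P_i`) — the mechanism by which the current `J` (a sum of `Im U(∂p)`) controls `[D*_UD_U, D_U]`. [folklore]
[cite: Balaban1985BackgroundPropagators, (3.11) p.392, (3.36) p.396] -/
theorem norm_sum_conj_sub_self_le {ι : Type*} [Fintype ι] (P : ι → 𝔸ˣ) {ε : ℝ} (hε : ∀ i, ‖(P i : 𝔸) - 1‖ ≤ ε)
    (hPi : ∀ i, ‖(((P i)⁻¹ : 𝔸ˣ) : 𝔸)‖ ≤ 1) (Y : 𝔸) :
    ‖∑ i, ((P i : 𝔸) * Y * (((P i)⁻¹ : 𝔸ˣ) : 𝔸) - Y)‖ ≤ (2 * ‖∑ i, imC (P i)‖ + 4 * Fintype.card ι * ε ^ 2) * ‖Y‖ := by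
  have hε0 : ∀ i, ‖(P i : 𝔸) - 1‖ ^ 2 ≤ ε ^ 2 := fun i => pow_le_pow_left₀ (norm_nonneg _) (hε i) 2
  have dec : ∀ i, (P i : 𝔸) * Y * (((P i)⁻¹ : 𝔸ˣ) : 𝔸) - Y =
      (((P i : 𝔸) * Y * (((P i)⁻¹ : 𝔸ˣ) : 𝔸) - Y) - (((P i : 𝔸) - 1) * Y - Y * ((P i : 𝔸) - 1))) +
      ((((P i : 𝔸) - 1) - I • imC (P i)) * Y - Y * (((P i : 𝔸) - 1) - I • imC (P i))) +
      ((I • imC (P i)) * Y - Y * (I • imC (P i))) := by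
    intro i; simp only [sub_mul, mul_sub]; abel
  have hsum : ∑ i, ((P i : 𝔸) * Y * (((P i)⁻¹ : 𝔸ˣ) : 𝔸) - Y) =
      ∑ i, (((P i : 𝔸) * Y * (((P i)⁻¹ : 𝔸ˣ) : 𝔸) - Y) - (((P i : 𝔸) - 1) * Y - Y * ((P i : 𝔸) - 1))) +
      ∑ i, ((((P i : 𝔸) - 1) - I • imC (P i)) * Y - Y * (((P i : 𝔸) - 1) - I • imC (P i))) +
      ((I • ∑ i, imC (P i)) * Y - Y * (I • ∑ i, imC (P i))) := by
    rw [Finset.smul_sum, Finset.sum_mul, Finset.mul_sum, ← Finset.sum_sub_distrib, ← Finset.sum_add_distrib, ← Finset.sum_add_distrib]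
    exact Finset.sum_congr rfl fun i _ => dec i
  rw [hsum]
  have hA : ∀ i, ‖((P i : 𝔸) * Y * (((P i)⁻¹ : 𝔸ˣ) : 𝔸) - Y) - (((P i : 𝔸) - 1) * Y - Y * ((P i : 𝔸) - 1))‖ ≤ 2 * ε ^ 2 * ‖Y‖ := fun i =>
    (norm_conj_sub_sub_comm_le (P i) (hPi i) Y).trans (by gcongr; exact hε i)
  have hB : ∀ i, ‖(((P i : 𝔸) - 1) - I • imC (P i)) * Y - Y * (((P i : 𝔸) - 1) - I • imC (P i))‖ ≤ 2 * ε ^ 2 * ‖Y‖ := by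
    intro i
    have h := norm_sub_one_sub_smul_imC_le (P i) (hPi i)
    calc _ ≤ ‖(((P i : 𝔸) - 1) - I • imC (P i)) * Y‖ + ‖Y * (((P i : 𝔸) - 1) - I • imC (P i))‖ := norm_sub_le _ _
      _ ≤ ‖((P i : 𝔸) - 1) - I • imC (P i)‖ * ‖Y‖ + ‖Y‖ * ‖((P i : 𝔸) - 1) - I • imC (P i)‖ := add_le_add (norm_mul_le _ _) (norm_mul_le _ _)
      _ ≤ ε ^ 2 * ‖Y‖ + ‖Y‖ * ε ^ 2 := by gcongr <;> exact h.trans (hε0 i)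
      _ = 2 * ε ^ 2 * ‖Y‖ := by ring
  have hC : ‖(I • ∑ i, imC (P i)) * Y - Y * (I • ∑ i, imC (P i))‖ ≤ 2 * ‖∑ i, imC (P i)‖ * ‖Y‖ := by
    have hI : ‖I • ∑ i, imC (P i)‖ = ‖∑ i, imC (P i)‖ := by rw [norm_smul, Complex.norm_I, one_mul]
    calc _ ≤ ‖(I • ∑ i, imC (P i)) * Y‖ + ‖Y * (I • ∑ i, imC (P i))‖ := norm_sub_le _ _
      _ ≤ ‖I • ∑ i, imC (P i)‖ * ‖Y‖ + ‖Y‖ * ‖I • ∑ i, imC (P i)‖ := add_le_add (norm_mul_le _ _) (norm_mul_le _ _)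
      _ = 2 * ‖∑ i, imC (P i)‖ * ‖Y‖ := by rw [hI]; ring
  calc _ ≤ ‖∑ i, (((P i : 𝔸) * Y * (((P i)⁻¹ : 𝔸ˣ) : 𝔸) - Y) - (((P i : 𝔸) - 1) * Y - Y * ((P i : 𝔸) - 1)))‖ +
        ‖∑ i, ((((P i : 𝔸) - 1) - I • imC (P i)) * Y - Y * (((P i : 𝔸) - 1) - I • imC (P i)))‖ +
        ‖(I • ∑ i, imC (P i)) * Y - Y * (I • ∑ i, imC (P i))‖ := norm_add₃_le
    _ ≤ ∑ i, ‖((P i : 𝔸) * Y * (((P i)⁻¹ : 𝔸ˣ) : 𝔸) - Y) - (((P i : 𝔸) - 1) * Y - Y * ((P i : 𝔸) - 1))‖ +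
        ∑ i, ‖(((P i : 𝔸) - 1) - I • imC (P i)) * Y - Y * (((P i : 𝔸) - 1) - I • imC (P i))‖ +
        ‖(I • ∑ i, imC (P i)) * Y - Y * (I • ∑ i, imC (P i))‖ := by
      gcongr <;> exact norm_sum_le _ _
    _ ≤ ∑ _i : ι, 2 * ε ^ 2 * ‖Y‖ + ∑ _i : ι, 2 * ε ^ 2 * ‖Y‖ + 2 * ‖∑ i, imC (P i)‖ * ‖Y‖ := by
      gcongr with i _ i _
      · exact hA i
      · exact hB i
    _ = (2 * ‖∑ i, imC (P i)‖ + 4 * Fintype.card ι * ε ^ 2) * ‖Y‖ := by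
      rw [Finset.sum_const, Finset.card_univ, nsmul_eq_mul]; ring

end Algebra

/-! ## §2 The current (3.11) on the model's torus, unfolded -/

section Current

variable {d : ℕ} {Pd : Fin d → ℕ} {𝔸 : Type*} [NormedRing 𝔸] [NormedAlgebra ℂ 𝔸]

omit [NormedAlgebra ℂ 𝔸] in
/-- `U(∂p_{κκ}) = 1` (degenerate plaquette). [folklore] [cite: Balaban1985BackgroundPropagators, (3.1) p.390] -/
theorem plaqU_self (U : Bond d Pd → 𝔸ˣ) (κ : Fin d) (x : TSite d Pd) :
    plaqU (fun μ => shiftEquiv (Pd := Pd) μ) (fun μ y => U (y, μ)) κ κ x = 1 := by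
  rw [plaqU, mul_inv_cancel_right, mul_inv_cancel]

/-- **THE CURRENT UNFOLDED**: on the torus `TSite d Pd` with the unit steps `shiftEquiv` and a bond configuration `U`,
`J_ν(x) = η⁻³·Σ_κ (U_{x−e_κ,κ}⁻¹·Im U(∂p_{κν}(x−e_κ))·U_{x−e_κ,κ} − Im U(∂p_{κν}(x)))` ((3.9) for the antisymmetric plaquette function `η⁻²Im U(∂p)`,
`B9Eq39Adjoint.divP_eq_sum_of_antisymm`; (3.8)'s transport `R(U(x, x−e_κ)) = R(U_{x−e_κ,κ}⁻¹)`). [folklore] [cite: Balaban1985BackgroundPropagators, (3.8)–(3.11) p.392] -/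
theorem J_eq_sum (U : Bond d Pd → 𝔸ˣ) (η : ℝ) (ν : Fin d) (x : TSite d Pd) :
    J (fun μ => shiftEquiv (Pd := Pd) μ) (fun μ y => U (y, μ)) η ν x =
      (((η : ℂ)⁻¹) ^ 3) • ∑ κ, ((((U (unshift κ x, κ))⁻¹ : 𝔸ˣ) : 𝔸) * imC (plaqU (fun μ => shiftEquiv (Pd := Pd) μ) (fun μ y => U (y, μ)) κ ν (unshift κ x)) *
        (U (unshift κ x, κ) : 𝔸) - imC (plaqU (fun μ => shiftEquiv (Pd := Pd) μ) (fun μ y => U (y, μ)) κ ν x)) := by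
  rw [J, divPη, divP_eq_sum_of_antisymm]
  · have h : ∀ κ, covDstar (fun μ => shiftEquiv (Pd := Pd) μ) (fun μ y => U (y, μ)) κ
        (fun y => (((η : ℂ)⁻¹) ^ 2) • imC (plaqU (fun μ => shiftEquiv (Pd := Pd) μ) (fun μ y => U (y, μ)) κ ν y)) x =
        (((η : ℂ)⁻¹) ^ 2) • ((((U (unshift κ x, κ))⁻¹ : 𝔸ˣ) : 𝔸) * imC (plaqU (fun μ => shiftEquiv (Pd := Pd) μ) (fun μ y => U (y, μ)) κ ν (unshift κ x)) *
          (U (unshift κ x, κ) : 𝔸) - imC (plaqU (fun μ => shiftEquiv (Pd := Pd) μ) (fun μ y => U (y, μ)) κ ν x)) := fun κ => by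
      rw [covDstar, B9Eq39Adjoint.R_smul, R_def, inv_inv, ← smul_sub]
      rfl
    simp only [h, ← Finset.smul_sum, smul_smul]
    congr 1
    ring
  · intro μ μ' y
    rw [imC_plaqU_swap, smul_neg]
  · intro μ y
    rw [plaqU_self, imC_one, smul_zero]

end Current

end Literature.MathematicalPhysics.QuantumFieldTheory.Balaban1983to89.B9Eq3117ConjugationDefects

end
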